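import Summits.BirchSwinnertonDyer.Rank1Residual.Additive.X4SharpThreeKimConjectureIsogeny
import Summits.BirchSwinnertonDyer.Rank1Residual.GaloisImage.IsogenySurjTransport
import Summits.BirchSwinnertonDyer.Rank1Residual.X4.KimConjectureIsogenyOptimal
import HarnessLib

/-!
# N11 (X4 ∧ `r = 0` ∧ `p = 3`) modulo the announced Kim 2025 clause: the integrality binder
# DISCHARGED, the OPTIMAL MEMBER decides the class, and the END STATE over optimal data
# (cell `b2b-bsdres`, seat additive-p4, GEN 18, line V35; sequel of V31/V32b with p09's T-R18b and V33-A)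

HONEST FRAMING (cell `b2b-bsdres`, run/shared/lean/b2b/bsd-rank1-residual/, verbatim in every
file): the goal of the cell is to DELETE the COMBINATION-SHAPED residual classes of the
Birch–Swinnerton-Dyer formula for ALL analytic-rank `≤ 1` elliptic curves over `ℚ` — "full BSD
formula for every rank `≤ 1` curve in class `C`" assembled STRICTLY from published theorems — so
that the rank-`≤ 1` remainder becomes exactly the CONSTRUCTION-SHAPED classes, which are TYPED
(missing-input `Prop`s), NOT attempted. This is not "finishing BSD". Seat `additive-p4`: research
route on the CONSTRUCTION-SHAPED class X4 / N11; theorems only — no definition, no named fact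
minted. EVERY theorem below is CONDITIONAL on the ANNOUNCED Kim 2025 clause
`Kim2025.thm11_kimShaLength_of_integralPeriod_OPEN` (C.-H. Kim, arXiv:2505.09121, Thm. 1.1 — a
PREPRINT, flag `Kim2025-preprint`; it enters as an explicitly labelled OPEN hypothesis `hK25s`, never
as a theorem). N11's mark is UNCHANGED; nothing is booked.

## What this file proves

V31 (`X4SharpThreeKimConjectureEndState.lean`) read the N11 end state on TOWER rows for data `D`
carrying two binders: the period transfer `hper` (`Ω(W) = u·Ω⁺_{D.f}`, `|u|_p = 1`) and the
`Ω⁺_f`-INTEGRALITY of the plus symbols `hint`. Since then: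
* n1011 p09 (T-R18b) PROVED `hint` on every irreducible row:
  `Additive.forall_padicValRat_ratPlusSymbol_nonneg_of_towerSurj` (`PlusSymbolIntegrality.lean`, p254396:
  Drinfeld–Manin via an Eisenstein multiple prime to `p` at every cusp). Its module is not yet built on
  the checking farm at the time of writing, so this file carries that THEOREM as ONE explicit global
  hypothesis `hInt` (stated in exactly its shape: `q ≠ 2`, `IsNewformOf V g`, tower ⟹ integrality);
  the sequel `…OptimalIntegral.lean` discharges `hInt := fun … ↦ forall_padicValRat_ratPlusSymbol_nonneg_of_towerSurj …`
  in one line — `hInt` is NOT a named fact and NOT an open statement;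
* `hper` is optimality + `p ∤ c` (`X4.periodTransfer_of_optimal`, V32);
* V33-A (`GaloisImage.towerSurj_iff_of_isIsogenous_of_classX4`): the TOWER is a class invariant.

So (namespace `Summit.BirchSwinnertonDyer.Rank1Residual.Additive`):
* §1 `missingPPartAt_iff_kimTamagawaDefectAt_of_kim2025_OPEN'` / `bsdp_iff_…'` — V31's per-pair iffs
  at `p ≥ 3` on tower rows with the per-datum `hint` binder replaced by the global `hInt` (any datum
  with the period transfer);
  `bsdp_iff_kimTamagawaDefectAt_of_optimal_of_kim2025_OPEN` — on an OPTIMAL conductor-level datum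
  with `p ∤ c`: NO binder beyond optimality (the `p = 3` twin of V32 §2);
* §2 **`bsdp_iff_kimTamagawaDefectAt_isogenous_optimal_of_kim2025_OPEN`** — for ANY member `W`
  (X4, `r_an = 0`, tower at `p ≥ 3`) and ANY optimal isogenous `(W₀, D₀)` with `p ∤ c`:
  `BSD(W,p) ⟺ X4.KimTamagawaDefectAt W₀ p D₀.f` (tower transported, Cassels) — Conj. 1.10 at the
  strong member decides the Cremona class at `3` too; `missingPPartAt_iff_…` twin;
* §3 **`n11_rankZero_three_iff_kimTamagawaDefect_optimal_of_kim2025_OPEN`** — THE N11 END STATE over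
  optimal data, NO integrality binder: "`MissingPPartAt` on every X4 ∧ `r_an = 0` ∧ surj(3) pair" ⟺
  (i) Conj. 1.10 at `3` on every OPTIMAL conductor-level datum with `3 ∤ c` of a TOWER curve ∧
  (ii) `MissingPPartAt` on the tower pairs NONE of whose isogenous strong data is prime to `3`
  (MANIN♭(3) proper — Edixhoven's theorem is silent at `p ≤ 7`; census: Cremona `c = 1` throughout) ∧
  (iii) `MissingPPartAt` on the EXOTIC pairs (surj(3), no tower; whole classes by V33-A).

References: C.-H. Kim, arXiv:2505.09121 (2025) Thm. 1.1 [Kim2025RefinedTNC, ANNOUNCED]; C.-H. Kim,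
Amer. J. Math. 148 (2026) Conj. 1.10 [Kim2022StructureSelmer]; J. W. S. Cassels 1965
[Cassels1965ArithmeticVIII]; R. L. Miller 2011 Def. 1.1 [Miller2011LMS]; Ju. I. Manin 1972 / V. G.
Drinfeld 1973 (cusp classes are torsion) via p09's file; CLASS-CLOSURE-PLAN.md §3.1.
-/

noncomputable section

open scoped Classical MatrixGroups ModularForm

open CongruenceSubgroup WeierstrassCurve Literature.NumberTheory.EllipticCurves
  Literature.NumberTheory.EllipticCurves.ModularForms
  Literature.NumberTheory.EllipticCurves.Rank1Residual
  Literature.NumberTheory.EllipticCurves.Rank1Residual.Typed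

namespace Summit.BirchSwinnertonDyer.Rank1Residual.Additive

/-! ### §1 The integrality binder discharged (p09's T-R18b) -/

section PerPair

variable (W : WeierstrassCurve ℚ) [W.IsElliptic] [W.IsGloballyMinimal] (p : ℕ) [hp : Fact p.Prime]

omit hp in
/-- `3 ≤ p` ⟹ `p ≠ 2` (bookkeeping). [folklore] -/
theorem ne_two_of_three_le (hp3 : 3 ≤ p) : p ≠ 2 := by omega

/-- **`Typed.MissingPPartAt W p ⟺ X4.KimTamagawaDefectAt W p D.f` on a tower row at `p ≥ 3`, modulo
the preprint, WITHOUT the integrality binder**: the `Ω⁺_f`-integrality of the plus symbols is p09's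
theorem on every tower (indeed irreducible) row. [claim: Kim2025RefinedTNC, status: under-review]
[cite: Kim2025RefinedTNC, Thm. 1.1 ("BSD") (ANNOUNCED, OPEN binder)] [cite: Kim2022StructureSelmer, Conj. 1.10 (PDF p. 8)]
[cite: Miller2011LMS, Def. 1.1] -/
theorem missingPPartAt_iff_kimTamagawaDefectAt_of_kim2025_OPEN'
    (hK25s : Kim2025.thm11_kimShaLength_of_integralPeriod_OPEN)
    (hGZK : rank_eq_analyticRank_of_analyticRank_le_one) (hmod : hasEntireLFunction_rat)
    (hInt : ∀ (V : WeierstrassCurve ℚ) [V.IsElliptic] [V.IsGloballyMinimal] (q : ℕ) [Fact q.Prime]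
      {M : ℕ} [NeZero M] (g : CuspForm (Gamma0 M) 2), q ≠ 2 → IsNewformOf V g →
      (∀ n : ℕ, V.HasSurjectiveModNGaloisRep (q ^ n : ℕ)) →
      ∀ r : ℚ, ratPlusSymbol g r ≠ 0 → 0 ≤ padicValRat q (ratPlusSymbol g r))
    (hp3 : 3 ≤ p) (hr : W.analyticRank = 0) (htower : ∀ n : ℕ, W.HasSurjectiveModNGaloisRep (p ^ n : ℕ))
    {N : ℕ} [NeZero N] (D : ModularParametrizationData W N)
    (hper : ∃ u : ℚ, ‖(u : ℚ_[p])‖ = 1 ∧ W.realPeriodRat = u * plusPeriod D.f) :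
    MissingPPartAt W p ↔ X4.KimTamagawaDefectAt W p D.f :=
  missingPPartAt_iff_kimTamagawaDefectAt_of_kim2025_OPEN W p hK25s hGZK hmod hp3 hr htower D hper
    (hInt W p D.f (ne_two_of_three_le p hp3) D.isNewformOf htower)

/-- **`BSD(E,p) ⟺ X4.KimTamagawaDefectAt W p D.f` on a tower row at `p ≥ 3`, modulo the preprint,
WITHOUT the integrality binder.** [claim: Kim2025RefinedTNC, status: under-review]
[cite: Kim2025RefinedTNC, Thm. 1.1 ("BSD") (ANNOUNCED, OPEN binder)] [cite: Kim2022StructureSelmer, Conj. 1.10 (PDF p. 8)]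
[cite: Miller2011LMS, §1 and Def. 1.1] -/
theorem bsdp_iff_kimTamagawaDefectAt_of_kim2025_OPEN'
    (hK25s : Kim2025.thm11_kimShaLength_of_integralPeriod_OPEN)
    (hGZK : rank_eq_analyticRank_of_analyticRank_le_one) (hmod : hasEntireLFunction_rat)
    (hInt : ∀ (V : WeierstrassCurve ℚ) [V.IsElliptic] [V.IsGloballyMinimal] (q : ℕ) [Fact q.Prime]
      {M : ℕ} [NeZero M] (g : CuspForm (Gamma0 M) 2), q ≠ 2 → IsNewformOf V g →
      (∀ n : ℕ, V.HasSurjectiveModNGaloisRep (q ^ n : ℕ)) →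
      ∀ r : ℚ, ratPlusSymbol g r ≠ 0 → 0 ≤ padicValRat q (ratPlusSymbol g r))
    (hp3 : 3 ≤ p) (hr : W.analyticRank = 0) (htower : ∀ n : ℕ, W.HasSurjectiveModNGaloisRep (p ^ n : ℕ))
    {N : ℕ} [NeZero N] (D : ModularParametrizationData W N)
    (hper : ∃ u : ℚ, ‖(u : ℚ_[p])‖ = 1 ∧ W.realPeriodRat = u * plusPeriod D.f) :
    BSDp W p ↔ X4.KimTamagawaDefectAt W p D.f :=
  bsdp_iff_kimTamagawaDefectAt_of_kim2025_OPEN W p hK25s hGZK hmod hp3 hr htower D hper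
    (hInt W p D.f (ne_two_of_three_le p hp3) D.isNewformOf htower)

/-- **On an OPTIMAL conductor-level datum with `p ∤ c`, `p ≥ 3`, tower row: `BSD(E,p) ⟺
X4.KimTamagawaDefectAt W p D.f` modulo the preprint — NO binder beyond optimality** (period transfer
by `X4.periodTransfer_of_optimal`, integrality by p09). The `p = 3` twin of V32 §2.
[claim: Kim2025RefinedTNC, status: under-review] [cite: Kim2025RefinedTNC, Thm. 1.1 ("BSD") (ANNOUNCED, OPEN binder)]
[cite: Kim2022StructureSelmer, Conj. 1.10 (PDF p. 8), §1.3.5] [cite: Miller2011LMS, §1 and Def. 1.1] -/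
theorem bsdp_iff_kimTamagawaDefectAt_of_optimal_of_kim2025_OPEN
    (hK25s : Kim2025.thm11_kimShaLength_of_integralPeriod_OPEN)
    (hGZK : rank_eq_analyticRank_of_analyticRank_le_one) (hmod : hasEntireLFunction_rat)
    (hInt : ∀ (V : WeierstrassCurve ℚ) [V.IsElliptic] [V.IsGloballyMinimal] (q : ℕ) [Fact q.Prime]
      {M : ℕ} [NeZero M] (g : CuspForm (Gamma0 M) 2), q ≠ 2 → IsNewformOf V g →
      (∀ n : ℕ, V.HasSurjectiveModNGaloisRep (q ^ n : ℕ)) →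
      ∀ r : ℚ, ratPlusSymbol g r ≠ 0 → 0 ≤ padicValRat q (ratPlusSymbol g r))
    (hp3 : 3 ≤ p) (hr : W.analyticRank = 0) (htower : ∀ n : ℕ, W.HasSurjectiveModNGaloisRep (p ^ n : ℕ))
    {N : ℕ} [NeZero N] (D : ModularParametrizationData W N)
    (hopt : ∀ z ∈ D.L.lattice, ∃ w ∈ periodLattice D.f, z = D.c * w)
    (hc : ¬ (p : ℤ) ∣ D.maninConstant) :
    BSDp W p ↔ X4.KimTamagawaDefectAt W p D.f :=
  bsdp_iff_kimTamagawaDefectAt_of_kim2025_OPEN' W p hK25s hGZK hmod hInt hp3 hr htower D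
    (X4.periodTransfer_of_optimal p D hopt hc)

end PerPair

/-! ### §2 The optimal member decides the class (p ≥ 3, tower classes) -/

section ClassTransport

variable (W W₀ : WeierstrassCurve ℚ) [W.IsElliptic] [W.IsGloballyMinimal] [W₀.IsElliptic]
  [W₀.IsGloballyMinimal] (p : ℕ) [hp : Fact p.Prime]

/-- **`BSD(W,p) ⟺` Conj. 1.10 at an OPTIMAL ISOGENOUS member, `p ≥ 3`, tower classes, modulo the
preprint**: `W` of class X4 with `r_an = 0` and `ρ̄_{W,p^n}` onto for all `n`; `W₀ ∼ W` globally
minimal with an optimal conductor-level datum `D₀`, `p ∤ c(D₀)` ⟹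
`BSD(W,p) ⟺ X4.KimTamagawaDefectAt W₀ p D₀.f`. The tower of `W₀` is TRANSPORTED from `W`
(`GaloisImage.towerSurj_iff_of_isIsogenous_of_classX4`), `BSD(·,p)` by Cassels.
[claim: Kim2025RefinedTNC, status: under-review] [cite: Kim2025RefinedTNC, Thm. 1.1 ("BSD") (ANNOUNCED, OPEN binder)]
[cite: Kim2022StructureSelmer, Conj. 1.10 (PDF p. 8)] [cite: Cassels1965ArithmeticVIII] [cite: Miller2011LMS, §1 and Def. 1.1] -/
theorem bsdp_iff_kimTamagawaDefectAt_isogenous_optimal_of_kim2025_OPEN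
    (hK25s : Kim2025.thm11_kimShaLength_of_integralPeriod_OPEN) (hCassels : bsdRHS_eq_of_isIsogenous)
    (hGZK : rank_eq_analyticRank_of_analyticRank_le_one) (hmod : hasEntireLFunction_rat)
    (hInt : ∀ (V : WeierstrassCurve ℚ) [V.IsElliptic] [V.IsGloballyMinimal] (q : ℕ) [Fact q.Prime]
      {M : ℕ} [NeZero M] (g : CuspForm (Gamma0 M) 2), q ≠ 2 → IsNewformOf V g →
      (∀ n : ℕ, V.HasSurjectiveModNGaloisRep (q ^ n : ℕ)) →
      ∀ r : ℚ, ratPlusSymbol g r ≠ 0 → 0 ≤ padicValRat q (ratPlusSymbol g r))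
    (hp3 : 3 ≤ p) (hr : W.analyticRank = 0) (hX : ClassX4 W p)
    (htower : ∀ n : ℕ, W.HasSurjectiveModNGaloisRep (p ^ n : ℕ))
    (hiso : IsIsogenous W₀ W) {N₀ : ℕ} [NeZero N₀] (D₀ : ModularParametrizationData W₀ N₀)
    (hopt₀ : ∀ z ∈ D₀.L.lattice, ∃ w ∈ periodLattice D₀.f, z = D₀.c * w)
    (hc₀ : ¬ (p : ℤ) ∣ D₀.maninConstant) :
    BSDp W p ↔ X4.KimTamagawaDefectAt W₀ p D₀.f := by
  have hr₀ : W₀.analyticRank = 0 := by rw [analyticRank_eq_of_isIsogenous' hiso, hr]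
  have ht₀ : ∀ n : ℕ, W₀.HasSurjectiveModNGaloisRep (p ^ n : ℕ) :=
    (GaloisImage.towerSurj_iff_of_isIsogenous_of_classX4 hiso.symm_of_isElliptic hX).mp htower
  rw [← bsdp_iff_kimTamagawaDefectAt_of_optimal_of_kim2025_OPEN W₀ p hK25s hGZK hmod hInt hp3 hr₀ ht₀ D₀
    hopt₀ hc₀]
  exact TwistComparison.bsdp_iff_bsdp_of_isIsogenous W W₀ p hCassels hGZK hmod hiso.symm_of_isElliptic
    (by rw [hr]; exact zero_le_one)

/-- **`Typed.MissingPPartAt W p ⟺` Conj. 1.10 at an optimal isogenous member** (same hypotheses).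
[claim: Kim2025RefinedTNC, status: under-review] [cite: Kim2025RefinedTNC, Thm. 1.1 ("BSD") (ANNOUNCED, OPEN binder)]
[cite: Kim2022StructureSelmer, Conj. 1.10 (PDF p. 8)] [cite: Cassels1965ArithmeticVIII] [cite: Miller2011LMS, Def. 1.1] -/
theorem missingPPartAt_iff_kimTamagawaDefectAt_isogenous_optimal_of_kim2025_OPEN
    (hK25s : Kim2025.thm11_kimShaLength_of_integralPeriod_OPEN) (hCassels : bsdRHS_eq_of_isIsogenous)
    (hGZK : rank_eq_analyticRank_of_analyticRank_le_one) (hmod : hasEntireLFunction_rat)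
    (hInt : ∀ (V : WeierstrassCurve ℚ) [V.IsElliptic] [V.IsGloballyMinimal] (q : ℕ) [Fact q.Prime]
      {M : ℕ} [NeZero M] (g : CuspForm (Gamma0 M) 2), q ≠ 2 → IsNewformOf V g →
      (∀ n : ℕ, V.HasSurjectiveModNGaloisRep (q ^ n : ℕ)) →
      ∀ r : ℚ, ratPlusSymbol g r ≠ 0 → 0 ≤ padicValRat q (ratPlusSymbol g r))
    (hp3 : 3 ≤ p) (hr : W.analyticRank = 0) (hX : ClassX4 W p)
    (htower : ∀ n : ℕ, W.HasSurjectiveModNGaloisRep (p ^ n : ℕ))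
    (hiso : IsIsogenous W₀ W) {N₀ : ℕ} [NeZero N₀] (D₀ : ModularParametrizationData W₀ N₀)
    (hopt₀ : ∀ z ∈ D₀.L.lattice, ∃ w ∈ periodLattice D₀.f, z = D₀.c * w)
    (hc₀ : ¬ (p : ℤ) ∣ D₀.maninConstant) :
    MissingPPartAt W p ↔ X4.KimTamagawaDefectAt W₀ p D₀.f := by
  have hr1 : W.analyticRank ≤ 1 := by rw [hr]; exact zero_le_one
  haveI : Finite W.sha := (hGZK W hr1).2
  rw [← bsdp_iff_kimTamagawaDefectAt_isogenous_optimal_of_kim2025_OPEN W W₀ p hK25s hCassels hGZK hmod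
    hInt hp3 hr hX htower hiso D₀ hopt₀ hc₀]
  exact ⟨bsdp_of_missingPPartAt W p hGZK hr1, missingPPartAt_of_bsdp W p⟩

end ClassTransport

/-! ### §3 The N11 END STATE over optimal data, modulo the preprint — no integrality binder -/

/-- **N11 END STATE over OPTIMAL data, CONDITIONAL on the announced Kim 2025 clause** (inputs:
`hK25s` OPEN, Cassels `hCassels`, GZK, modularity — nothing else; compare V31's
`n11_rankZero_three_iff_kimTamagawaDefect_of_kim2025_OPEN`, whose data carried the period-transfer
and integrality binders): "`MissingPPartAt W 3` on every X4 ∧ `r_an = 0` ∧ surj(3) pair" ⟺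
(i) Kim's Conjecture 1.10 at `3` on every OPTIMAL conductor-level datum with `3 ∤ c` of a TOWER curve
(X4, `r_an = 0`) ∧ (ii) `MissingPPartAt W 3` on the tower pairs NONE of whose isogenous globally
minimal curves carries an optimal conductor-level datum with `3 ∤ c` (MANIN♭(3) proper) ∧
(iii) `MissingPPartAt W 3` on the EXOTIC pairs (surj(3), no `3`-adic tower). Every other tower class
is decided at its strong member by §2. [claim: Kim2025RefinedTNC, status: under-review]
[cite: Kim2025RefinedTNC, Thm. 1.1 ("BSD") (ANNOUNCED, OPEN binder)] [cite: Kim2022StructureSelmer, Conj. 1.10 (PDF p. 8)]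
[cite: Cassels1965ArithmeticVIII] [cite: Miller2011LMS, §1 and Def. 1.1] -/
theorem n11_rankZero_three_iff_kimTamagawaDefect_optimal_of_kim2025_OPEN
    (hK25s : Kim2025.thm11_kimShaLength_of_integralPeriod_OPEN) (hCassels : bsdRHS_eq_of_isIsogenous)
    (hGZK : rank_eq_analyticRank_of_analyticRank_le_one) (hmod : hasEntireLFunction_rat)
    (hInt : ∀ (V : WeierstrassCurve ℚ) [V.IsElliptic] [V.IsGloballyMinimal] (q : ℕ) [Fact q.Prime]
      {M : ℕ} [NeZero M] (g : CuspForm (Gamma0 M) 2), q ≠ 2 → IsNewformOf V g →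
      (∀ n : ℕ, V.HasSurjectiveModNGaloisRep (q ^ n : ℕ)) →
      ∀ r : ℚ, ratPlusSymbol g r ≠ 0 → 0 ≤ padicValRat q (ratPlusSymbol g r)) :
    (∀ (W : WeierstrassCurve ℚ) [W.IsElliptic] [W.IsGloballyMinimal],
        W.analyticRank = 0 → ClassX4 W 3 → Surj W 3 → MissingPPartAt W 3) ↔
      (∀ (W : WeierstrassCurve ℚ) [W.IsElliptic] [W.IsGloballyMinimal],
          W.analyticRank = 0 → ClassX4 W 3 → (∀ n : ℕ, W.HasSurjectiveModNGaloisRep (3 ^ n : ℕ)) →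
          ∀ {N : ℕ} [NeZero N] (D : ModularParametrizationData W N), W.conductorNorm ℤ = N →
          (∀ z ∈ D.L.lattice, ∃ w ∈ periodLattice D.f, z = D.c * w) → ¬ (3 : ℤ) ∣ D.maninConstant →
          X4.KimTamagawaDefectAt W 3 D.f) ∧
      (∀ (W : WeierstrassCurve ℚ) [W.IsElliptic] [W.IsGloballyMinimal],
          W.analyticRank = 0 → ClassX4 W 3 → (∀ n : ℕ, W.HasSurjectiveModNGaloisRep (3 ^ n : ℕ)) →
          (∀ (W₀ : WeierstrassCurve ℚ) [W₀.IsElliptic] [W₀.IsGloballyMinimal], IsIsogenous W₀ W →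
            ∀ (N₀ : ℕ) [NeZero N₀] (D₀ : ModularParametrizationData W₀ N₀),
              W₀.conductorNorm ℤ ≠ N₀ ∨ (¬ ∀ z ∈ D₀.L.lattice, ∃ w ∈ periodLattice D₀.f, z = D₀.c * w) ∨
              (3 : ℤ) ∣ D₀.maninConstant) →
          MissingPPartAt W 3) ∧
      (∀ (W : WeierstrassCurve ℚ) [W.IsElliptic] [W.IsGloballyMinimal],
          W.analyticRank = 0 → ClassX4 W 3 → Surj W 3 →
          ¬ (∀ n : ℕ, W.HasSurjectiveModNGaloisRep (3 ^ n : ℕ)) → MissingPPartAt W 3) := by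
  haveI : Fact (Nat.Prime 3) := ⟨Nat.prime_three⟩
  have h3 : (3 : ℕ) ≤ 3 := le_rfl
  constructor
  · intro hN11
    refine ⟨fun W _ _ hr hX ht N _ D _ hopt hc ↦ ?_, fun W _ _ hr hX ht _ ↦ ?_,
      fun W _ _ hr hX hs _ ↦ hN11 W hr hX hs⟩
    · have hs : W.HasSurjectiveModNGaloisRep 3 := by simpa using ht 1
      have hr1 : W.analyticRank ≤ 1 := by rw [hr]; exact zero_le_one
      haveI : Finite W.sha := (hGZK W hr1).2
      exact (bsdp_iff_kimTamagawaDefectAt_of_optimal_of_kim2025_OPEN W 3 hK25s hGZK hmod hInt h3 hr ht D hopt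
        (by exact_mod_cast hc)).mp (bsdp_of_missingPPartAt W 3 hGZK hr1 (hN11 W hr hX hs))
    · have hs : W.HasSurjectiveModNGaloisRep 3 := by simpa using ht 1
      exact hN11 W hr hX hs
  · rintro ⟨hconj, hres, hexo⟩ W _ _ hr hX hs
    by_cases ht : ∀ n : ℕ, W.HasSurjectiveModNGaloisRep (3 ^ n : ℕ)
    · by_cases hD : ∃ (W₀ : WeierstrassCurve ℚ) (_ : W₀.IsElliptic) (_ : W₀.IsGloballyMinimal),
          IsIsogenous W₀ W ∧
          ∃ (N₀ : ℕ) (_ : NeZero N₀) (D₀ : ModularParametrizationData W₀ N₀),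
            W₀.conductorNorm ℤ = N₀ ∧ (∀ z ∈ D₀.L.lattice, ∃ w ∈ periodLattice D₀.f, z = D₀.c * w) ∧
            ¬ (3 : ℤ) ∣ D₀.maninConstant
      · obtain ⟨W₀, _, _, hiso, N₀, _, D₀, hN₀, hopt₀, hc₀⟩ := hD
        have hX₀ : ClassX4 W₀ 3 := (X2.classX4_iff_of_isIsogenous hiso).mpr hX
        have hr₀ : W₀.analyticRank = 0 := by rw [analyticRank_eq_of_isIsogenous' hiso, hr]
        have ht₀ : ∀ n : ℕ, W₀.HasSurjectiveModNGaloisRep (3 ^ n : ℕ) :=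
          (GaloisImage.towerSurj_iff_of_isIsogenous_of_classX4 hiso.symm_of_isElliptic hX).mp ht
        exact (missingPPartAt_iff_kimTamagawaDefectAt_isogenous_optimal_of_kim2025_OPEN W W₀ 3 hK25s
          hCassels hGZK hmod hInt h3 hr hX ht hiso D₀ hopt₀ (by exact_mod_cast hc₀)).mpr
          (hconj W₀ hr₀ hX₀ ht₀ D₀ hN₀ hopt₀ hc₀)
      · refine hres W hr hX ht fun W₀ _ _ hiso N₀ _ D₀ ↦ ?_
        by_contra hnot
        simp only [not_or, not_not] at hnot
        exact hD ⟨W₀, inferInstance, inferInstance, hiso, N₀, inferInstance, D₀, hnot.1, hnot.2.1,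
          hnot.2.2⟩
    · exact hexo W hr hX hs ht

end Summit.BirchSwinnertonDyer.Rank1Residual.Additive

end
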